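import Summits.Ventures.HSemireg.Pad4TowerSeedB1OddFloor
import Summits.Ventures.HSemireg.Pad4TowerSeedB1OddCeiling
import Summits.Ventures.HSemireg.Pad4TowerRuleDMu4Dual

/-!
# Cruxes ∕ BlochSeedDiscOne — `LineConfinement h`: the KERNEL RULES a structural proof composes, `LineConfinement 2` PROVED, and why `h ≥ 4` is a death DAG (prover `hsemireg-kernel-confine-1` g0, BLOCK F of R19.171)

HONEST FRAMING. Crux of record stmt-HodgeConjecture-18881 `BlochSeedDiscOne` (skeleton `Lines/birth.lean` 814a6a70c14e831a UNTOUCHED). Object: the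
typed candidate **`LineConfinement h`** of `Cruxes/BlochSeedDiscOne/ThinnessTarget.lean` v4 5e3e2b19541b6dc4 §6 (anomaly lens g7, A19): «in a
`◇_h`-supported, `G₁`-closed, `H₁`-static support every THICK cell (≥ 2 charged letters) is SINGLE-LINE (all four letters have the same causal height
`α + c`)». `LineConfinement 8` is **NOT proved here** (nor refuted); its bottom rung `LineConfinement 2` IS (§7; `LineConfinement` is antitone in `h`, §2). This file is census-neutral: no σ, no seed, no design verdict; NOTHING HERE SAYS THAT
HC ∕ HC_CM ∕ HC_AV ∕ H2 ∕ 18881 ∕ (T_h) HOLDS OR FAILS. No `sorry`, no `axiom`, no `instance`, no notation, no Literature fact; imports built `Pad4Tower*`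
modules only (cross-workfile imports under `Cruxes/` do not build, so §1 RESTATES the four definitions of ThinnessTarget §1∕§6 byte-for-byte in the
namespace `…AnomalyLens.ConfinementKernel`; the two `LineConfinement`s are syntactically identical terms).

WHY A RULES FILE AND NOT THE THEOREM (prover's reading, evidence in the seat folder `work/py/`, encoder = anomaly kit19b `gen2/mirror/fastuni` ⊕ cadical,
×1, hub): (a) `LineConfinement` is ANTITONE in `h` (§2), so the full small diamonds are necessary cases: the machine law holds at FULL ◇₄ (15 letters,
792 orbits∕level, 54 437 clauses, UNSAT) and FULL ◇₆ (28 letters, 7 945 orbits∕level, 1 170 350 clauses, UNSAT) — new rows below A19's TL₈ depth 2∕4;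
(b) at a FULL diamond RULE D alone kills nothing (the whole ◇_h is RULE-D-closed), every death is an `X⁺`∕`A2I⁻` interaction; (c) the refutations are
GLOBAL: a deletion-minimal core for the single cell `N[O|O|ℓ₋₁|ℓ₋₁]` at ◇₄ has 390 clauses (DN 187, DP 130, X⁺ 29, A2I⁻ 44), and the set of orbits
occurring in SOME static support is 17∕1 584 (◇₄) resp. 46∕15 890 (◇₆). So a kernel proof of `LineConfinement 8` is a lemma hierarchy («death DAG») of
the whole `H₁` game at height 8 — the same object as a kernel (T₈) — and not a local instability of one cell. What IS uniform and kernel are the RULES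
such a hierarchy composes; they are proved here for every `h` and for OFF-LINE supports (the on-line rules are `CeilingLineGame.lean` §6′∕§6″).

CONTENT (all PROVED, h-uniform).
* §1 the restated target; §2 **`lineConfinement_antitone : h' ≤ h → LineConfinement h → LineConfinement h'`** (◇_{h'} ⊆ ◇_h, the hypotheses are h-free).
* §3 LETTER CALCULUS of ◇_h: every letter is `t·I + c·ℓ_{i^κ} = ray (t,0,0) κ c` (`shape_of_inDiamond`); a μ₄ letter strictly null-below ∕ -above a
  CHARGED letter of phase `κ` lies in direction `κ` (own: the LINE coordinate `α + c` moves) or `κ + 2` (antipodal: the CO-LINE `α − c` moves) —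
  `dir_below_of_charged`, `dir_above_of_charged`; hence `SettledBelow` at a charged factor in frame direction `κ` ∕ `κ+2` IS an own ∕ antipodal leg
  (`ownLeg_of_settledBelow`, `antipLeg_of_settledBelow`) and dually above.
* §4 THE SERVICE RULES OFF THE LINE: **(R-N0)** an `N`-cell with a FLOOR letter (`α = c`: `O` or a pure ray) forces, on every other CHARGED factor, the
  own-down leg, and the antipodal-down leg too when that letter is off the floor (`floor_forces_own_leg`, `floor_forces_antip_leg`); **(R-P_h)** a `P`-cell
  with a CEILING letter (`α + c = h`) forces, on every other charged factor, the antipodal-up server, and the own-up server too when that letter is below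
  the ceiling (`ceiling_forces_antip_server`, `ceiling_forces_own_server`). [tree engine `settledBelow_of_stuck` ∕ `settledAbove_of_stuck` + §3]
* §5 `X⁺` in ORIGINAL coordinates: `XPlusFires`, `xresXFires_dual_iff` (it IS the tree's `XresXFires` on `C.dual 0`), `xPlusClosed_iff_orig`, and the `X⁺` RULE
  `xPlus_rule` (two children of one `N`-cell on one factor in two directions ⇒ an upward leg∕cover or an `He`∕`Hb` breaker on every other factor of the charged child);
  and the `A2I⁻` RULE `a2iMinus_rule` (the tree's `XresA2IFires`, contraposed with its five escape families displayed).
* §6 the decomposition **`lineConfinement_iff_pair_apex : LineConfinement h ↔ ChargedPairLaw h ∧ ThickApexLaw h`** (the two-factor form the anatomy exposes: at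
  ◇₄ every multi-line thick orbit contains a dead letter PAIR, at ◇₆ all but 10 orbit classes, which contain a dead triple).
* §7 **`lineConfinement_two : LineConfinement 2` — KERNEL**, by exactly the advertised mechanism («X⁺∕A2I⁻ instability of a multi-line thick cell given RULE-D
  service»): (i) `N → P` transfer of cells with `O` and a unit (`floor_forces_own_leg` + tree `a2i_swap_kill` + `S₄`), (ii) `ceiling_forces_antip_server` lifts the
  second unit, (iii) `lift_of_ceiling_unit_h` + `ceiling_forces_two_dirs` + (R-N0) + `S₄` produce the sibling and tree `xplus_ceiling_kill_h` fires. The machine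
  MUS of the same statement has 40 clauses; one rung up (◇₄) the cores are 390 (one cell) ∕ 450–610 (one letter pair): the argument does not close there, which
  is the content of (c) above.
* §8 two h-UNIFORM death-DAG edges (the easy multi-line thick deaths): `not_lower_O_fu_cu_top`, `not_upper_O_fu_cu_cu`.
* §9 `decide` probes.

What a proof of `LineConfinement 8` would need on top (recorded, not typed): the death DAG itself — ≈ 46 000 multi-line thick orbits at ◇₈; per-cell cores have
median 32 clauses at FULL ◇₄ but 353 at FULL ◇₆ (READ-F2 §4): most cells die by short chains of the rules above, a hard near-alive residue needs the global argument. -/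

namespace Summit.Ventures.HSemireg.Pad4Tower

namespace AnomalyLens

namespace ConfinementKernel

open Finset

/-! ## §1 The target, restated byte-for-byte from `ThinnessTarget.lean` §1∕§6 -/

/-- the number of CHARGED letters of a cell (`x` charged := `x.2 ≠ (0,0)`). [= ThinnessTarget `chargedCount`] -/
abbrev chargedCount (Z : MCell) : ℕ := (univ.filter fun f : Fin 4 => (Z f).2 ≠ (0, 0)).card

/-- a cell is THIN: at most one of its four letters is charged. [= ThinnessTarget `ThinCell`] -/
abbrev ThinCell (Z : MCell) : Prop := chargedCount Z ≤ 1

/-- a cell is SINGLE-LINE: all four letters have the same causal height `α + c`. [= ThinnessTarget `SingleLine`] -/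
abbrev SingleLine (Z : MCell) : Prop := ∀ f, (Z f).1 + absCharge (Z f) = (Z 0).1 + absCharge (Z 0)

/-- **`LineConfinement h`** [= ThinnessTarget §6 `LineConfinement`, verbatim]: in a `◇_h`-supported, `G₁`-closed, `H₁`-static support every cell
that is NOT thin is single-line — on both levels. Proved here for NO `h`. -/
def LineConfinement (h : ℤ) : Prop :=
  ∀ C : MConfig, C.InDiamond h → C.G1Closed → C.StaticH1 →
    (∀ Z ∈ C.lower, ¬ ThinCell Z → SingleLine Z) ∧ ∀ P ∈ C.upper, ¬ ThinCell P → SingleLine P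

/-! ## §2 Antitonicity in the height -/

/-- `◇_{h'} ⊆ ◇_h` for `h' ≤ h`, letterwise. -/
theorem inDiamond_mono {h' h : ℤ} (hle : h' ≤ h) {x : BPoint} (hx : InDiamond h' x) : InDiamond h x :=
  ⟨hx.1, hx.2.1, hx.2.2.1, le_trans hx.2.2.2 hle⟩

/-- … and for configurations. -/
theorem inDiamond_mono_cfg {h' h : ℤ} (hle : h' ≤ h) {C : MConfig} (hC : C.InDiamond h') : C.InDiamond h :=
  ⟨fun Z hZ f => inDiamond_mono hle (hC.1 Z hZ f), fun P hP f => inDiamond_mono hle (hC.2 P hP f)⟩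

/-- **`LineConfinement` is ANTITONE in `h`**: the hypotheses `G1Closed`, `StaticH1` and the conclusion do not mention `h`, and a `◇_{h'}` support is a
`◇_h` support. Hence the FULL small diamonds ◇₄, ◇₆ are necessary cases of `LineConfinement 8` (machine rows in the module docstring). -/
theorem lineConfinement_antitone {h' h : ℤ} (hle : h' ≤ h) (H : LineConfinement h) : LineConfinement h' :=
  fun C hD hG hS => H C (inDiamond_mono_cfg hle hD) hG hS

/-! ## §3 Letter calculus of ◇_h -/

/-- every ◇_h letter is `t·I + c·ℓ_{i^κ} = ray (t,0,0) κ c` with `t ≥ 0` even, `c = absCharge ≥ 0`, `t + 2c ≤ h` (for the apex, `κ` is arbitrary). -/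
theorem shape_of_inDiamond {h : ℤ} {x : BPoint} (hx : InDiamond h x) :
    ∃ (t c : ℤ) (κ : Fin 4), 0 ≤ t ∧ 0 ≤ c ∧ t % 2 = 0 ∧ t + 2 * c ≤ h ∧ c = absCharge x ∧ x = ray (t, 0, 0) κ c := by
  obtain ⟨α, b1, b2⟩ := x
  obtain ⟨hax, hc, hpar, hh⟩ := hx
  simp only [absCharge, chargeOf] at hc hpar hh ⊢
  rcases hax with h0 | ⟨h1, h2⟩ | ⟨h1, h2⟩
  · simp only [Prod.mk.injEq] at h0
    obtain ⟨rfl, rfl⟩ := h0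
    simp only [sub_zero, abs_zero] at hc hpar hh ⊢
    exact ⟨α, 0, 0, hc, le_refl _, by simpa using hpar, by omega, rfl, by simp [ray]⟩
  · simp only at h1 h2
    subst h2
    simp only [sub_zero] at hc hpar hh ⊢
    rcases lt_or_gt_of_ne h1 with hneg | hpos
    · refine ⟨α - |b1|, |b1|, 2, by omega, abs_nonneg _, by omega, by omega, rfl, ?_⟩
      rw [abs_of_neg hneg]; simp [ray]
    · refine ⟨α - |b1|, |b1|, 0, by omega, abs_nonneg _, by omega, by omega, rfl, ?_⟩
      rw [abs_of_pos hpos]; simp [ray]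
  · simp only at h1 h2
    subst h1
    simp only [zero_sub, abs_neg] at hc hpar hh ⊢
    rcases lt_or_gt_of_ne h2 with hneg | hpos
    · refine ⟨α - |b2|, |b2|, 1, by omega, abs_nonneg _, by omega, by omega, rfl, ?_⟩
      rw [abs_of_neg hneg]; simp [ray]
    · refine ⟨α - |b2|, |b2|, 3, by omega, abs_nonneg _, by omega, by omega, rfl, ?_⟩
      rw [abs_of_pos hpos]; simp [ray]

/-- a charged letter in shape form is not the apex, and conversely the charge of a non-apex ◇ letter is `≥ 1`. -/
theorem one_le_absCharge_of_not_isApex {h : ℤ} {x : BPoint} (hx : InDiamond h x) (hna : ¬ isApex x) : 1 ≤ absCharge x := by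
  obtain ⟨α, b1, b2⟩ := x
  obtain ⟨hax, -, -, -⟩ := hx
  simp only [isApex, not_and_or] at hna
  simp only [absCharge, chargeOf]
  rcases hax with h0 | ⟨h1, h2⟩ | ⟨h1, h2⟩
  · simp only [Prod.mk.injEq] at h0; obtain ⟨rfl, rfl⟩ := h0; simp at hna
  · simp only at h1 h2; subst h2; simp only [sub_zero]
    have := abs_pos.mpr h1; omega
  · simp only at h1 h2; subst h1; simp only [zero_sub, abs_neg]
    have := abs_pos.mpr h2; omega

/-- the LINE (causal height) and CO-LINE of a letter in shape form: `α + c = t + 2c`, `α − c = t`; in its own frame the two coordinates are exactly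
these (`coord x κ = t + 2c`, `coord x (κ+2) = t`). -/
theorem coords_of_shape (t : ℤ) {c : ℤ} (hc : 0 ≤ c) (κ : Fin 4) :
    absCharge (ray (t, 0, 0) κ c) = c ∧ coord (ray (t, 0, 0) κ c) κ = t + 2 * c ∧ coord (ray (t, 0, 0) κ c) (κ + 2) = t ∧
      Adapted (ray (t, 0, 0) κ c) κ ∧ Adapted (ray (t, 0, 0) κ c) (κ + 2) := by
  have h1 : |c| = c := abs_of_nonneg hc
  have h2 : |-c| = c := by rw [abs_neg]; exact h1
  fin_cases κ <;> simp [absCharge, chargeOf, coord, Adapted, h1, h2] <;> ring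

/-- **BELOW a charged letter only the own and the antipodal direction stay μ₄**: if `y` (with `β` on an axis or zero) lies strictly null-below
`x = t·I + c·ℓ_{i^κ}`, `c ≥ 1`, in direction `r`, then `r = κ` or `r = κ + 2`. -/
theorem dir_below_of_charged {t c : ℤ} (hc : 1 ≤ c) {κ r : Fin 4} {y : BPoint} (hy : y.2 = (0, 0) ∨ AxisPt y)
    (hlt : y.1 < (ray (t, 0, 0) κ c).1) (hray : ray (t, 0, 0) κ c = ray y r ((ray (t, 0, 0) κ c).1 - y.1)) : r = κ ∨ r = κ + 2 := by
  obtain ⟨a, b1, b2⟩ := y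
  simp only [ray, Prod.mk.injEq] at hray hlt
  obtain ⟨-, hr1, hr2⟩ := hray
  fin_cases κ <;> fin_cases r <;> simp [AxisPt] at hr1 hr2 hy ⊢ <;> omega

/-- **ABOVE a charged letter only the own and the antipodal direction stay μ₄**: if `y` (with `β` on an axis or zero) is `x + e·n_r`, `e ≥ 1`,
`x = t·I + c·ℓ_{i^κ}`, `c ≥ 1`, then `r = κ` or `r = κ + 2`. -/
theorem dir_above_of_charged {t c : ℤ} (hc : 1 ≤ c) {κ r : Fin 4} {y : BPoint} (hy : y.2 = (0, 0) ∨ AxisPt y)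
    (hlt : (ray (t, 0, 0) κ c).1 < y.1) (hray : y = ray (ray (t, 0, 0) κ c) r (y.1 - (ray (t, 0, 0) κ c).1)) : r = κ ∨ r = κ + 2 := by
  obtain ⟨a, b1, b2⟩ := y
  simp only [ray, Prod.mk.injEq] at hray hlt
  obtain ⟨-, hr1, hr2⟩ := hray
  fin_cases κ <;> fin_cases r <;> simp [AxisPt] at hr1 hr2 hy ⊢ <;> omega

/-- every ◇_h letter has `β` on an axis or zero (the μ₄ hypothesis of the two direction lemmas). -/
theorem axis_of_inDiamond {h : ℤ} {x : BPoint} (hx : InDiamond h x) : x.2 = (0, 0) ∨ AxisPt x := hx.1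

section Legs

variable {C : MConfig} {h : ℤ}

/-- at a CHARGED factor `g` of an `N`-cell (letter `t·I + c·ℓ_{i^κ}`, `c ≥ 1`), «the coordinate `(g, κ)` is settled below» IS an OWN-DOWN LEG
(a `P`-cell `Z(g ↦ Z_g − d·n_κ)`), provided the `P`-letters are μ₄ (e.g. in ◇_h). -/
theorem ownLeg_of_settledBelow (hU : C.InDiamond h) {Z : MCell} {g : Fin 4} {t c : ℤ} (hc : 1 ≤ c) {κ : Fin 4} (hZg : Z g = ray (t, 0, 0) κ c)
    (hS : SettledBelow C Z g κ) : ∃ P ∈ C.upper, UPartner Z P g κ := by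
  obtain ⟨r, hr, P, hP, hag, hlt, hray⟩ := hS
  have hdir := dir_below_of_charged hc (y := P g) (axis_of_inDiamond (hU.2 P hP g)) (by rw [← hZg]; exact hlt) (by rw [← hZg]; exact hray)
  rcases hdir with rfl | rfl
  · exact ⟨P, hP, hag, hlt, hray⟩
  · exact absurd rfl hr

/-- … and «the coordinate `(g, κ+2)` is settled below» IS an ANTIPODAL-DOWN LEG. -/
theorem antipLeg_of_settledBelow (hU : C.InDiamond h) {Z : MCell} {g : Fin 4} {t c : ℤ} (hc : 1 ≤ c) {κ : Fin 4} (hZg : Z g = ray (t, 0, 0) κ c)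
    (hS : SettledBelow C Z g (κ + 2)) : ∃ P ∈ C.upper, UPartner Z P g (κ + 2) := by
  obtain ⟨r, hr, P, hP, hag, hlt, hray⟩ := hS
  have hdir := dir_below_of_charged hc (y := P g) (axis_of_inDiamond (hU.2 P hP g)) (by rw [← hZg]; exact hlt) (by rw [← hZg]; exact hray)
  rcases hdir with rfl | rfl
  · exfalso; apply hr; fin_cases r <;> decide
  · exact ⟨P, hP, hag, hlt, hray⟩

/-- dually at a `P`-cell: «`(g, κ)` settled above» IS an OWN-UP server … -/
theorem ownServer_of_settledAbove (hU : C.InDiamond h) {P : MCell} {g : Fin 4} {t c : ℤ} (hc : 1 ≤ c) {κ : Fin 4} (hPg : P g = ray (t, 0, 0) κ c)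
    (hS : SettledAbove C P g κ) : ∃ N ∈ C.lower, UPartner N P g κ := by
  obtain ⟨r, hr, N, hN, hag, hlt, hray⟩ := hS
  have hdir := dir_above_of_charged hc (y := N g) (axis_of_inDiamond (hU.1 N hN g)) (by rw [← hPg]; exact hlt) (by rw [← hPg]; exact hray)
  rcases hdir with rfl | rfl
  · exact ⟨N, hN, hag, hlt, hray⟩
  · exact absurd rfl hr

/-- … and «`(g, κ+2)` settled above» IS an ANTIPODAL-UP server. -/
theorem antipServer_of_settledAbove (hU : C.InDiamond h) {P : MCell} {g : Fin 4} {t c : ℤ} (hc : 1 ≤ c) {κ : Fin 4}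
    (hPg : P g = ray (t, 0, 0) κ c) (hS : SettledAbove C P g (κ + 2)) : ∃ N ∈ C.lower, UPartner N P g (κ + 2) := by
  obtain ⟨r, hr, N, hN, hag, hlt, hray⟩ := hS
  have hdir := dir_above_of_charged hc (y := N g) (axis_of_inDiamond (hU.1 N hN g)) (by rw [← hPg]; exact hlt) (by rw [← hPg]; exact hray)
  rcases hdir with rfl | rfl
  · exfalso; apply hr; fin_cases r <;> decide
  · exact ⟨N, hN, hag, hlt, hray⟩

end Legs

/-! ## §4 The service rules off the line: (R-N0) at a floor letter, (R-P_h) at a ceiling letter -/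

section Rules

variable {C : MConfig} {h : ℤ}

/-- ◇_h letters are effective from `O` (`|β| = c ≤ α`): the cone hypothesis of the tree engine. -/
theorem effective_of_inDiamond' {x : BPoint} (hx : InDiamond h x) : Effective x := by
  obtain ⟨α, b1, b2⟩ := x
  obtain ⟨hax, hc, -, -⟩ := hx
  simp only [absCharge, chargeOf] at hc
  have hα : 0 ≤ α := le_trans (abs_nonneg _) hc
  rcases hax with h0 | ⟨-, h2⟩ | ⟨h1, -⟩
  · simp only [Prod.mk.injEq] at h0
    obtain ⟨rfl, rfl⟩ := h0
    exact ⟨hα, by nlinarith⟩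
  · simp only at h2; subst h2
    refine ⟨hα, ?_⟩
    simp only [sub_zero] at hc
    have := abs_le.1 hc
    show b1 ^ 2 + 0 ^ 2 ≤ α ^ 2
    nlinarith [this.1, this.2]
  · simp only at h1; subst h1
    refine ⟨hα, ?_⟩
    simp only [zero_sub, abs_neg] at hc
    have := abs_le.1 hc
    show 0 ^ 2 + b2 ^ 2 ≤ α ^ 2
    nlinarith [this.1, this.2]

/-- a FLOOR letter (`α = c`) of ◇_h is the apex `O` or a pure ray `c·ℓ_{i^k}` (`lpt c k`, `c ≥ 1`). -/
theorem floor_letter_cases {x : BPoint} (hx : InDiamond h x) (hfl : OnFloor x) : x = (0, 0, 0) ∨ ∃ (c : ℤ) (k : Fin 4), 1 ≤ c ∧ x = lpt c k := by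
  obtain ⟨t, c, κ, ht, hc, -, -, hcabs, rfl⟩ := shape_of_inDiamond hx
  have ht0 : t = 0 := by
    simp only [OnFloor] at hfl
    rw [← hcabs] at hfl
    fin_cases κ <;> simp at hfl <;> omega
  subst ht0
  rcases (show c = 0 ∨ 1 ≤ c by omega) with rfl | h1
  · left; fin_cases κ <;> simp [ray]
  · right; exact ⟨c, κ, h1, by simp [lpt]⟩

/-- the tree engine at a floor factor, both cases at once: at a RULE-D `N`-cell `Z` inside ◇_h with a FLOOR letter on `i`, every adapted coordinate
with a NON-ZERO value on every other factor is settled below. [`settledBelow_of_O` ∕ `settledBelow_of_ray`] -/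
theorem settledBelow_of_floor (hU : C.InDiamond h) {Z : MCell} (hZ : Z ∈ C.lower) (hD : RuleDMu4N C Z) {i : Fin 4} (hfl : OnFloor (Z i))
    {g k : Fin 4} (hg : g ≠ i) (hadk : Adapted (Z g) k) (hne : coord (Z g) k ≠ 0) : SettledBelow C Z g k := by
  have hcone : ∀ P ∈ C.upper, ∀ f, Effective (P f) := fun P hP f => effective_of_inDiamond' (hU.2 P hP f)
  rcases floor_letter_cases (hU.1 Z hZ i) hfl with hO | ⟨c, k₀, hc, hray⟩
  · exact settledBelow_of_O hD hcone hO hg hadk hne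
  · exact settledBelow_of_ray hD hcone hc hray hg hadk hne

/-- **(R-N0), own leg.** At a RULE-D `N`-cell inside ◇_h with a FLOOR letter on `i`, every other CHARGED factor `g` (letter `t·I + c·ℓ_{i^κ}`, `c ≥ 1`)
carries an OWN-DOWN LEG: a `P`-cell `Z(g ↦ Z_g − d·n_κ)`, `d ≥ 1` (the LINE coordinate `t + 2c ≠ 0` must be served, and only the own direction serves it). -/
theorem floor_forces_own_leg (hU : C.InDiamond h) {Z : MCell} (hZ : Z ∈ C.lower) (hD : RuleDMu4N C Z) {i g : Fin 4} (hg : g ≠ i)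
    (hfl : OnFloor (Z i)) {t c : ℤ} (ht : 0 ≤ t) (hc : 1 ≤ c) {κ : Fin 4} (hZg : Z g = ray (t, 0, 0) κ c) :
    ∃ P ∈ C.upper, UPartner Z P g κ := by
  obtain ⟨-, hco, -, had, -⟩ := coords_of_shape t (by omega : 0 ≤ c) κ
  refine ownLeg_of_settledBelow hU hc hZg (settledBelow_of_floor hU hZ hD hfl hg (by rw [hZg]; exact had) ?_)
  rw [hZg, hco]; omega

/-- **(R-N0), antipodal leg.** Same, when the charged letter on `g` is OFF THE FLOOR (`t ≥ 2`, i.e. co-line `α − c ≠ 0`): `Z` also carries an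
ANTIPODAL-DOWN LEG `Z(g ↦ Z_g − d·n_{κ+2})` on `g` — so `Z` has legs on `g` in TWO DIFFERENT DIRECTIONS (the premise pattern of `X⁺`). -/
theorem floor_forces_antip_leg (hU : C.InDiamond h) {Z : MCell} (hZ : Z ∈ C.lower) (hD : RuleDMu4N C Z) {i g : Fin 4} (hg : g ≠ i)
    (hfl : OnFloor (Z i)) {t c : ℤ} (ht : 1 ≤ t) (hc : 1 ≤ c) {κ : Fin 4} (hZg : Z g = ray (t, 0, 0) κ c) :
    ∃ P ∈ C.upper, UPartner Z P g (κ + 2) := by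
  obtain ⟨-, -, hco, -, had⟩ := coords_of_shape t (by omega : 0 ≤ c) κ
  refine antipLeg_of_settledBelow hU hc hZg (settledBelow_of_floor hU hZ hD hfl hg (by rw [hZg]; exact had) ?_)
  rw [hZg, hco]; omega

/-- **(R-N0), apex factor.** Same, when the other factor `g` carries an apex `t·I` with `t ≥ 1`: `Z` is served below on `g` in (at least) TWO
DIFFERENT DIRECTIONS (every frame coordinate of the apex equals `t ≠ 0`, and one leg direction `r` leaves the coordinate `r + 2` unsettled). -/
theorem floor_forces_two_dirs (hU : C.InDiamond h) {Z : MCell} (hZ : Z ∈ C.lower) (hD : RuleDMu4N C Z) {i g : Fin 4} (hg : g ≠ i)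
    (hfl : OnFloor (Z i)) {t : ℤ} (ht : 1 ≤ t) (hZg : Z g = (t, 0, 0)) :
    ∃ r₁ r₂ : Fin 4, r₁ ≠ r₂ ∧ MServedBelow C Z g r₁ ∧ MServedBelow C Z g r₂ := by
  have hset : ∀ k : Fin 4, SettledBelow C Z g k := fun k =>
    settledBelow_of_floor hU hZ hD hfl hg (by rw [hZg]; fin_cases k <;> simp [Adapted]) (by rw [hZg]; fin_cases k <;> simp [coord] <;> omega)
  obtain ⟨r₁, -, h₁⟩ := hset 0
  obtain ⟨r₂, hr₂, h₂⟩ := hset (r₁ + 2)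
  refine ⟨r₁, r₂, ?_, h₁, h₂⟩
  intro e; apply hr₂; rw [← e]; fin_cases r₁ <;> decide

/-- a CEILING letter (`α + c = h`) of ◇_h admits no ◇_h letter strictly null-above it in its OWN direction (the line would exceed `h`), and none
at all if it is the apex `h·I`; what remains is the antipodal direction. Stated as: a ◇_h letter `y` strictly above the ceiling letter
`t·I + c·ℓ_{i^κ}` (`c ≥ 1`, `t + 2c = h`) in direction `r` has `r = κ + 2`. -/
theorem dir_above_ceiling {t c : ℤ} (hc : 1 ≤ c) {κ r : Fin 4} {y : BPoint} (hy : InDiamond h y) (hh : t + 2 * c = h)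
    (hlt : (ray (t, 0, 0) κ c).1 < y.1) (hray : y = ray (ray (t, 0, 0) κ c) r (y.1 - (ray (t, 0, 0) κ c).1)) : r = κ + 2 := by
  have hA := hy.2.2.2
  have hax := hy.1
  obtain ⟨a, b1, b2⟩ := y
  simp only [ray, Prod.mk.injEq] at hray hlt
  obtain ⟨-, hr1, hr2⟩ := hray
  simp only [absCharge, chargeOf, Int.abs_eq_natAbs] at hA
  fin_cases κ <;> fin_cases r <;> simp [AxisPt] at hr1 hr2 hax hlt ⊢ <;> omega

/-- nothing of ◇_h lies strictly above the top node `h·I`. -/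
theorem not_above_top {y : BPoint} (hy : InDiamond h y) : ¬ h < y.1 := by
  have := (inDiamond_bounds hy).2.1; omega

/-- the tree engine at a ceiling factor: at a RULE-D `P`-cell inside ◇_h with a CEILING letter on `i` (charged or the top node), every adapted
coordinate with a value `≠ h` on every other factor is settled above. [`settledAbove_of_stuck`: the LINE coordinate `h` of the ceiling letter is
neither settled (own-up leaves ◇_h, §3) nor coverable (a cover would move it own-up, `DirOK`)] -/
theorem settledAbove_of_ceiling (hU : C.InDiamond h) {P : MCell} (hP : P ∈ C.upper) (hD : RuleDMu4P C P) {i : Fin 4} (hcl : OnCeiling h (P i))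
    {g k : Fin 4} (hg : g ≠ i) (hadk : Adapted (P g) k) (hne : coord (P g) k ≠ h) : SettledAbove C P g k := by
  obtain ⟨t, c, κ, ht, hc0, -, -, hcabs, hPi⟩ := shape_of_inDiamond (hU.2 P hP i)
  have hh : t + 2 * c = h := by
    simp only [OnCeiling] at hcl; rw [← hcabs, hPi] at hcl; revert hcl; fin_cases κ <;> simp <;> intro h1 <;> omega
  obtain ⟨-, hco, -, had, -⟩ := coords_of_shape t hc0 κ
  rcases (show c = 0 ∨ 1 ≤ c by omega) with rfl | hc
  · -- the top node: stuck in every direction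
    have htop : P i = (h, 0, 0) := by rw [hPi]; fin_cases κ <;> simp <;> omega
    have hstuck : ¬ SettledAbove C P i 0 := by
      rintro ⟨r, -, N, hN, -, hlt, -⟩
      exact not_above_top (hU.1 N hN i) (by rw [htop] at hlt; simpa using hlt)
    have hnocov : ∀ j k', ¬ CoveredAbove C P i 0 j k' := by
      rintro j k' ⟨a, b, -, -, N, hN, -, hlt, -⟩
      exact not_above_top (hU.1 N hN i) (by rw [htop] at hlt; simpa using hlt)
    refine settledAbove_of_stuck hD (by rw [htop]; simp [Adapted]) hstuck hnocov hg hadk ?_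
    rw [htop]; simpa [coord] using hne
  · -- a charged ceiling letter: its LINE coordinate (κ) is stuck
    have hstuck : ¬ SettledAbove C P i κ := by
      rintro ⟨r, hr, N, hN, -, hlt, hray⟩
      rw [hPi] at hlt hray
      exact hr (dir_above_ceiling hc (hU.1 N hN i) hh hlt hray)
    have hnocov : ∀ j k', ¬ CoveredAbove C P i κ j k' := by
      rintro j k' ⟨a, b, ha, -, N, hN, -, hlt, hray, -⟩
      rw [hPi] at hlt hray ha
      have := dir_above_ceiling hc (hU.1 N hN i) hh hlt hray
      subst this
      rcases ha with e | ⟨hap, -⟩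
      · revert e; fin_cases κ <;> decide
      · revert hap; fin_cases κ <;> simp [isApex] <;> omega
    refine settledAbove_of_stuck hD (by rw [hPi]; exact had) hstuck hnocov hg hadk ?_
    rw [hPi, hco, hh]; exact hne

/-- **(R-P_h), antipodal server.** At a RULE-D `P`-cell inside ◇_h with a CEILING letter on `i`, every other CHARGED factor `g` (letter
`t·I + c·ℓ_{i^κ}`, `c ≥ 1`) carries an ANTIPODAL-UP SERVER: an `N`-cell `P(g ↦ P_g + e·n_{κ+2})` (the CO-LINE coordinate `t < h` must be served). -/
theorem ceiling_forces_antip_server (hU : C.InDiamond h) {P : MCell} (hP : P ∈ C.upper) (hD : RuleDMu4P C P) {i g : Fin 4} (hg : g ≠ i)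
    (hcl : OnCeiling h (P i)) {t c : ℤ} (hc : 1 ≤ c) {κ : Fin 4} (hPg : P g = ray (t, 0, 0) κ c) :
    ∃ N ∈ C.lower, UPartner N P g (κ + 2) := by
  have hhg := (hU.2 P hP g).2.2.2
  obtain ⟨hcabs, -, hco, -, had⟩ := coords_of_shape t (by omega : 0 ≤ c) κ
  refine antipServer_of_settledAbove hU hc hPg (settledAbove_of_ceiling hU hP hD hcl hg (by rw [hPg]; exact had) ?_)
  rw [hPg, hco]
  rw [hPg, hcabs] at hhg
  have : (ray (t, 0, 0) κ c).1 = t + c := by fin_cases κ <;> simp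
  rw [this] at hhg
  omega

/-- **(R-P_h), own server.** Same, when the charged letter on `g` is BELOW THE CEILING (`t + 2c < h`): `P` also carries an OWN-UP SERVER
`P(g ↦ P_g + d·n_κ)` — so `P` is served above on `g` in TWO DIFFERENT DIRECTIONS (the premise pattern of `X⁻`, which is NOT in `H₁`). -/
theorem ceiling_forces_own_server (hU : C.InDiamond h) {P : MCell} (hP : P ∈ C.upper) (hD : RuleDMu4P C P) {i g : Fin 4} (hg : g ≠ i)
    (hcl : OnCeiling h (P i)) {t c : ℤ} (hc : 1 ≤ c) {κ : Fin 4} (hPg : P g = ray (t, 0, 0) κ c) (hlow : t + 2 * c < h) :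
    ∃ N ∈ C.lower, UPartner N P g κ := by
  obtain ⟨-, hco, -, had, -⟩ := coords_of_shape t (by omega : 0 ≤ c) κ
  refine ownServer_of_settledAbove hU hc hPg (settledAbove_of_ceiling hU hP hD hcl hg (by rw [hPg]; exact had) ?_)
  rw [hPg, hco]; omega

/-- **(R-P_h), apex factor.** Same, when the other factor `g` carries an apex `t·I` with `t < h`: `P` is served above on `g` in TWO DIFFERENT DIRECTIONS. -/
theorem ceiling_forces_two_dirs (hU : C.InDiamond h) {P : MCell} (hP : P ∈ C.upper) (hD : RuleDMu4P C P) {i g : Fin 4} (hg : g ≠ i)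
    (hcl : OnCeiling h (P i)) {t : ℤ} (hth : t ≠ h) (hPg : P g = (t, 0, 0)) :
    ∃ r₁ r₂ : Fin 4, r₁ ≠ r₂ ∧ MServedAbove C P g r₁ ∧ MServedAbove C P g r₂ := by
  have hset : ∀ k : Fin 4, SettledAbove C P g k := fun k =>
    settledAbove_of_ceiling hU hP hD hcl hg (by rw [hPg]; fin_cases k <;> simp [Adapted]) (by rw [hPg]; fin_cases k <;> simp [coord] <;> exact hth)
  obtain ⟨r₁, -, h₁⟩ := hset 0
  obtain ⟨r₂, hr₂, h₂⟩ := hset (r₁ + 2)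
  refine ⟨r₁, r₂, ?_, h₁, h₂⟩
  intro e; apply hr₂; rw [← e]; fin_cases r₁ <;> decide

end Rules

/-! ## §5 `X⁺` IN ORIGINAL COORDINATES (de-dualised once and for all) and the `X⁺` RULE

`XPlusClosed C := XresXClosed (C.dual 0)` (tree). Every seat fighting `X⁺` re-translates the dual clause by hand (`xplus_ceiling_kill_h`, …); here the
translation is done ONCE: `XPlusFires C P q n σ u w f` is the `X⁺` clause in the ORIGINAL world — head a `P`-cell `P` with charged `σ`-letter, PARENT an
`N`-cell `q = P(σ ↦ P_σ + d·n_u)` that is the NEAREST `N` above `P` on that ray, a second CHILD `n = q(σ ↦ q_σ − e·n_w) ∈ upper`, `w ≠ u`, with no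
`N`-cell strictly between `n` and `q` on the `w`-ray, and the three absence conditions (no `He`-breaker, no `Hb`-breaker, `W_f(P) = ∅` read upwards:
`P` is not served above through `f`, neither by a leg nor by an (r2a) cover) — and `xresXFires_dual_iff` proves it IS the tree's clause on the dual. -/

section XPlusOrig

variable {C : MConfig}

/-- componentwise: the dual difference is the reversed difference. -/
theorem bsub_dual (h : ℤ) (x y : BPoint) : bsub (dualPt h x) (dualPt h y) = bsub y x := by
  obtain ⟨x1, x2, x3⟩ := x; obtain ⟨y1, y2, y3⟩ := y
  simp only [bsub, Prod.mk.injEq]; refine ⟨by ring, by ring, by ring⟩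

/-- «strictly null-below» dualises to «strictly null-above». -/
theorem nullBelow_dual (h : ℤ) (x y : BPoint) : NullBelow (dualPt h y) (dualPt h x) ↔ NullBelow x y := by
  obtain ⟨x1, x2, x3⟩ := x; obtain ⟨y1, y2, y3⟩ := y
  simp only [NullBelow]
  constructor
  · rintro ⟨h1, h2⟩; exact ⟨by omega, by nlinarith [h2]⟩
  · rintro ⟨h1, h2⟩; exact ⟨by omega, by nlinarith [h2]⟩

/-- a point equation against a ray dualises with the charge negated. -/
theorem eq_ray_dual (h : ℤ) (x y : BPoint) (k : Fin 4) (e : ℤ) : dualPt h x = ray (dualPt h y) k e ↔ x = ray y k (-e) := by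
  obtain ⟨x1, x2, x3⟩ := x; obtain ⟨y1, y2, y3⟩ := y
  fin_cases k <;> simp [ray, Prod.ext_iff] <;> omega

/-- quantifying over the dual's `P`-cells is quantifying over the original `N`-cells. -/
theorem forall_dual_upper (h : ℤ) {Φ : MCell → Prop} : (∀ P' ∈ (C.dual h).upper, Φ P') ↔ ∀ N ∈ C.lower, Φ (dualCell h N) := by
  constructor
  · intro H N hN; exact H _ (dualCell_mem_dual_upper hN)
  · intro H P' hP'
    have := H _ (mem_dual_upper.mp hP')
    rwa [dualCell_dualCell] at this

/-- **`X⁺` FIRES, original coordinates.** Head `P ∈ upper` (charged `σ`-letter), demand factor `f ≠ σ`; parent `q ∈ lower` above `P` on `σ` in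
direction `u`, NEAREST such; second child `n ∈ upper` of `q` on `σ` in direction `w ≠ u` with no `N`-cell strictly between `n` and `q` on that ray;
no `He`-breaker (an `N`-cell `P(σ ↦ y)`, `y ≠ P_σ`, causally above `n_σ`, not timelike from `P_σ`, NOT causally below `q_σ`); no `Hb`-breaker (an
`N`-cell agreeing with `P` off `{σ, f}`, strictly null-above `P` on `f`, causally above `n_σ` on `σ` and not timelike from `P_σ` there); and
`W_f(P) = ∅` upwards (no `N`-cell strictly null-above `P` on `f` that agrees with `P` off `f`, or off `{f, g}` with `g` also strictly null-above). -/
abbrev XPlusFires (C : MConfig) (P q n : MCell) (σ u w f : Fin 4) : Prop :=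
  ¬ isApex (P σ) ∧ f ≠ σ ∧ UPartner q P σ u ∧ (∀ N ∈ C.lower, UPartner N P σ u → (q σ).1 ≤ (N σ).1) ∧
    w ≠ u ∧ UPartner q n σ w ∧
    (∀ N ∈ C.lower, MAgree q N σ → (N σ).1 < (q σ).1 → (n σ).1 < (N σ).1 → N σ ≠ ray (q σ) w ((N σ).1 - (q σ).1)) ∧
    (∀ N ∈ C.lower, MAgree P N σ → N σ ≠ P σ → Effective (bsub (N σ) (n σ)) → ¬ Timelike (bsub (P σ) (N σ)) →
      Effective (bsub (q σ) (N σ))) ∧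
    (∀ N ∈ C.lower, MAgree2 P N σ f → NullBelow (P f) (N f) → Effective (bsub (N σ) (n σ)) → Timelike (bsub (P σ) (N σ))) ∧
    (∀ N ∈ C.lower, NullBelow (P f) (N f) → ¬ MAgree P N f ∧ ∀ g, g ≠ f → MAgree2 P N f g → ¬ NullBelow (P g) (N g))

/-- **the tree's `X⁺` clause on the dual IS `XPlusFires` on the original** (conjunct by conjunct through `Pad4TowerRuleDMu4Dual`). -/
theorem xresXFires_dual_iff (P q n : MCell) (σ u w f : Fin 4) :
    XresXFires (C.dual 0) (dualCell 0 P) (dualCell 0 q) (dualCell 0 n) σ u w f ↔ XPlusFires C P q n σ u w f := by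
  unfold XresXFires XPlusFires NoCompanion HeOkP HbOkP WfEmpty
  refine and_congr ?_ (and_congr Iff.rfl (and_congr ?_ (and_congr ?_ (and_congr Iff.rfl (and_congr ?_ (and_congr ?_
    (and_congr ?_ (and_congr ?_ ?_))))))))
  · exact (isApex_dual 0 (P σ)).not
  · exact uPartner_dual 0 q P σ u
  · rw [forall_dual_upper]
    refine forall₂_congr fun N _ => ?_
    rw [uPartner_dual]
    constructor
    · intro H hNP; have := H hNP; change 0 - (N σ).1 ≤ 0 - (q σ).1 at this; omega
    · intro H hNP; have := H hNP; change 0 - (N σ).1 ≤ 0 - (q σ).1; omega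
  · -- Sibling ↔ UPartner q n σ w
    show (MAgree (dualCell 0 n) (dualCell 0 q) σ ∧ _ ∧ _) ↔ (MAgree n q σ ∧ _ ∧ _)
    rw [magree_dual]
    refine and_congr ⟨fun hg g hgσ => (hg g hgσ).symm, fun hg g hgσ => (hg g hgσ).symm⟩ ?_
    exact ray_dual_iff 0 (q σ) (n σ) w
  · -- NoCompanion
    rw [forall_dual_upper]
    refine forall₂_congr fun N _ => ?_
    rw [magree_dual]
    have e : ((dualCell 0 N) σ).1 - ((dualCell 0 q) σ).1 = -((N σ).1 - (q σ).1) := by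
      show (0 - (N σ).1) - (0 - (q σ).1) = _; ring
    rw [e]
    constructor
    · intro H hag h1 h2
      have H' := H hag (by show 0 - (q σ).1 < 0 - (N σ).1; omega) (by show 0 - (N σ).1 < 0 - (n σ).1; omega)
      rw [ne_eq, eq_ray_dual, neg_neg] at H'
      exact H'
    · intro H hag h1 h2
      change 0 - (q σ).1 < 0 - (N σ).1 at h1
      change 0 - (N σ).1 < 0 - (n σ).1 at h2
      rw [ne_eq, eq_ray_dual, neg_neg]
      exact H hag (by omega) (by omega)
  · -- He
    rw [forall_dual_upper]
    refine forall₂_congr fun N _ => ?_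
    rw [magree_dual]
    simp only [dualCell, bsub_dual]
    rw [(dualPt_injective 0).ne_iff]
  · -- Hb
    rw [forall_dual_upper]
    refine forall₂_congr fun N _ => ?_
    rw [magree2_dual]
    simp only [dualCell, bsub_dual, nullBelow_dual]
  · -- W_f
    rw [forall_dual_upper]
    refine forall₂_congr fun N _ => ?_
    simp only [dualCell, nullBelow_dual]
    refine imp_congr Iff.rfl (and_congr ?_ (forall_congr' fun g => imp_congr Iff.rfl (imp_congr ?_ ?_)))
    · exact (magree_dual (h := 0)).not
    · exact magree2_dual (h := 0)
    · exact Iff.rfl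

/-- hence **`XPlusClosed` in original coordinates**: no `P`-cell, parent and sibling make `XPlusFires` true. -/
theorem xPlusClosed_iff_orig (C : MConfig) :
    XPlusClosed C ↔ ∀ P ∈ C.upper, ∀ q ∈ C.lower, ∀ n ∈ C.upper, ∀ σ u w f : Fin 4, ¬ XPlusFires C P q n σ u w f := by
  unfold XPlusClosed XresXClosed
  constructor
  · intro H P hP q hq n hn σ u w f hF
    exact H _ (dualCell_mem_dual_lower hP) _ (dualCell_mem_dual_upper hq) _ (dualCell_mem_dual_lower hn) σ u w f
      ((xresXFires_dual_iff P q n σ u w f).mpr hF)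
  · intro H Z' hZ' q' hq' n' hn' σ u w f hF
    have e1 := dualCell_dualCell 0 Z'; have e2 := dualCell_dualCell 0 q'; have e3 := dualCell_dualCell 0 n'
    rw [← e1, ← e2, ← e3] at hF
    exact H _ (mem_dual_lower.mp hZ') _ (mem_dual_upper.mp hq') _ (mem_dual_lower.mp hn') σ u w f
      ((xresXFires_dual_iff _ _ _ σ u w f).mp hF)

/-- **THE `X⁺` RULE (original coordinates).** In an `X⁺`-closed configuration, let the `N`-cell `q` have two CHILDREN on the factor `σ` in two
different directions: `P = q(σ ↦ q_σ − d·n_u) ∈ upper` with `P_σ` charged and `q` the nearest `N` above `P` on that ray, and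
`n = q(σ ↦ q_σ − e·n_w) ∈ upper`, `w ≠ u`, with no `N`-cell strictly between `n` and `q`. Then for every other factor `f ≠ σ` ONE OF THE BREAKERS IS
PRESENT: `P` is served above through `f` (a leg or an (r2a) cover touching `f`), or an `He`-breaker, or an `Hb`-breaker. This is the instability that
meets RULE D's forced pairs of legs ((R-N0) apex∕off-floor factors, §4). -/
theorem xPlus_rule (hX : XPlusClosed C) {P q n : MCell} (hP : P ∈ C.upper) (hq : q ∈ C.lower) (hn : n ∈ C.upper) {σ u w f : Fin 4}
    (hna : ¬ isApex (P σ)) (hf : f ≠ σ) (hqP : UPartner q P σ u) (hnear : ∀ N ∈ C.lower, UPartner N P σ u → (q σ).1 ≤ (N σ).1)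
    (hwu : w ≠ u) (hqn : UPartner q n σ w)
    (hgap : ∀ N ∈ C.lower, MAgree q N σ → (N σ).1 < (q σ).1 → (n σ).1 < (N σ).1 → N σ ≠ ray (q σ) w ((N σ).1 - (q σ).1)) :
    (∃ N ∈ C.lower, NullBelow (P f) (N f) ∧ (MAgree P N f ∨ ∃ g, g ≠ f ∧ MAgree2 P N f g ∧ NullBelow (P g) (N g))) ∨
    (∃ N ∈ C.lower, MAgree P N σ ∧ N σ ≠ P σ ∧ Effective (bsub (N σ) (n σ)) ∧ ¬ Timelike (bsub (P σ) (N σ)) ∧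
      ¬ Effective (bsub (q σ) (N σ))) ∨
    (∃ N ∈ C.lower, MAgree2 P N σ f ∧ NullBelow (P f) (N f) ∧ Effective (bsub (N σ) (n σ)) ∧ ¬ Timelike (bsub (P σ) (N σ))) := by
  have H := (xPlusClosed_iff_orig C).mp hX P hP q hq n hn σ u w f
  by_contra hno
  apply H
  refine ⟨hna, hf, hqP, hnear, hwu, hqn, hgap, ?_, ?_, ?_⟩
  · intro N hN hag hne he ht
    by_contra hc; exact hno (Or.inr (Or.inl ⟨N, hN, hag, hne, he, ht, hc⟩))
  · intro N hN hag hnb he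
    by_contra hc; exact hno (Or.inr (Or.inr ⟨N, hN, hag, hnb, he, hc⟩))
  · intro N hN hnb
    exact ⟨fun hag => hno (Or.inl ⟨N, hN, hnb, Or.inl hag⟩), fun g hg hag2 hnb2 => hno (Or.inl ⟨N, hN, hnb, Or.inr ⟨g, hg, hag2, hnb2⟩⟩)⟩

end XPlusOrig

/-! ### The `A2I⁻` RULE (the tree's `XresA2IFires` is already in original coordinates; this is its contrapositive with the five escape families displayed) -/

section A2IRule

variable {C : MConfig}

/-- **THE `A2I⁻` RULE.** In an `A2I⁻`-closed configuration, let the `N`-cell `Z` have a charged `σ`-letter with encoder direction `u`, a `u`-partner `q ∈ upper`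
(own-ray leg, within the guard `d ≤ c`), and let `q` also lie under an `N`-cell `N'` through another factor `f' ≠ σ` in direction `v`. Then ONE OF THE ESCAPES IS
PRESENT: (a) a partner of `Z` on `σ` in another direction, (b) a shallower `u`-partner, (c) a `P`-cell on the `u`-line strictly below `q`, (d) a below-partner of
`Z` on `f'` (leg or (r2a) cover, strictly null-below) whose `f'`-direction is NOT `v`, (e) a polluter (a `P`-cell agreeing with `Z` off `{σ, f'}`, `σ`-letter on
the `u`-line at or below `q_σ`, `f'`-letter null-lifted along `v` by `1 … e` or spacelike-lifted below `N'_{f'}`). -/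
theorem a2iMinus_rule (hA : A2IMinusClosed C) {Z q N' : MCell} (hZ : Z ∈ C.lower) (hq : q ∈ C.upper) (hN' : N' ∈ C.lower)
    {σ u f' v : Fin 4} (hna : ¬ isApex (Z σ)) (hE : EncDir (Z σ) u) (hqZ : UPartner Z q σ u)
    (hguard : 0 ≤ (Z σ).1 → (Z σ).1 - (q σ).1 ≤ cabs (Z σ)) (hf : f' ≠ σ) (hN'q : UPartner N' q f' v) :
    (∃ P ∈ C.upper, ∃ w : Fin 4, w ≠ u ∧ UPartner Z P σ w) ∨
    (∃ P ∈ C.upper, UPartner Z P σ u ∧ (q σ).1 < (P σ).1) ∨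
    (∃ P ∈ C.upper, UPartner q P σ u) ∨
    (∃ P ∈ C.upper, NullBelow (P f') (Z f') ∧ (MAgree P Z f' ∨ ∃ g : Fin 4, g ≠ f' ∧ MAgree2 P Z f' g ∧ NullBelow (P g) (Z g)) ∧
      Z f' ≠ ray (P f') v ((Z f').1 - (P f').1)) ∨
    (∃ P ∈ C.upper, (∀ g, g ≠ σ → g ≠ f' → P g = Z g) ∧ OnULineBelowEq (P σ) (q σ) u ∧
      (((Z f').1 < (P f').1 ∧ (P f').1 ≤ (N' f').1 ∧ P f' = ray (Z f') v ((P f').1 - (Z f').1)) ∨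
        (Effective (bsub (N' f') (P f')) ∧ Spacelike (bsub (P f') (Z f'))))) := by
  by_contra hno
  apply hA Z hZ q hq N' hN' σ u f' v
  refine ⟨hna, hE, hqZ, hguard, hf, hN'q, ?_, ?_, ?_, ?_, ?_⟩
  · intro P hP w hw hPZ; exact hno (Or.inl ⟨P, hP, w, hw, hPZ⟩)
  · intro P hP hPZ; by_contra hlt; exact hno (Or.inr (Or.inl ⟨P, hP, hPZ, by omega⟩))
  · intro P hP hPq; exact hno (Or.inr (Or.inr (Or.inl ⟨P, hP, hPq⟩)))
  · intro P hP hnb hshape; by_contra hne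
    exact hno (Or.inr (Or.inr (Or.inr (Or.inl ⟨P, hP, hnb, hshape, fun h => hne h⟩))))
  · intro P hP hag hul
    refine ⟨fun h3 => hno (Or.inr (Or.inr (Or.inr (Or.inr ⟨P, hP, hag, hul, Or.inl h3⟩)))),
      fun h4 => hno (Or.inr (Or.inr (Or.inr (Or.inr ⟨P, hP, hag, hul, Or.inr h4⟩))))⟩

end A2IRule

/-! ## §6 THE DECOMPOSITION `LineConfinement h ↔ ChargedPairLaw h ∧ ThickApexLaw h` (the shape of the machine anatomy)

MACHINE ANATOMY (prover, ×1, hub; `work/py/pairs.py`, `pairs2.py` on the alive sets): at FULL ◇₄ the multi-line thick cells are EXACTLY the thick cells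
containing a dead LETTER PAIR (two letters that co-occur in no cell of any static support): `LineConfinement 4` = the pair law; at FULL ◇₆ all but 10
multi-line thick orbit classes contain a dead pair, and those 10 (`N[4I|4I|4I+ℓ|4I+ℓ′]`, `N[4I|4I+ℓ³…]`, `P[2I|2I|2I+ℓ|2I+ℓ′]`, `P[2I|2I+ℓ|2I+ℓ′|4I]`, …) contain a
dead TRIPLE. The alive charged pairs are all SAME-LINE (◇₆: `N` only `{4I+ℓ, 4I+ℓ^{=,±}}` on line 6; `P` `{2I+ℓ,2I+ℓ^{=,±}}`, `{4I+ℓ,4I+ℓ^{=,±}}`,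
`{2I+2ℓ, 2I+2ℓ^{=,±}}`, `{2I+2ℓ, 4I+ℓ_any}`). So the natural targets are the TWO-FACTOR law below and its apex companion; their conjunction IS
`LineConfinement` (proved here, pure logic). Each dead pair is still a global refutation (deletion-minimal cores 450–610 clauses at ◇₄). -/

/-- a CHARGED letter: `β ≠ 0`. -/
abbrev Charged (x : BPoint) : Prop := x.2 ≠ (0, 0)

/-- the causal height (LINE) of a letter. -/
abbrev lineOf (x : BPoint) : ℤ := x.1 + absCharge x

/-- **`ChargedPairLaw h`** (two-factor form; proved for NO `h`; machine = the alive-pair tables at ◇₄∕◇₆): in a `◇_h`-supported `G₁`-closed `H₁`-static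
support, two CHARGED letters of one cell lie on the same line. -/
def ChargedPairLaw (h : ℤ) : Prop :=
  ∀ C : MConfig, C.InDiamond h → C.G1Closed → C.StaticH1 → ∀ Z, (Z ∈ C.lower ∨ Z ∈ C.upper) →
    ∀ f g, Charged (Z f) → Charged (Z g) → lineOf (Z f) = lineOf (Z g)

/-- **`ThickApexLaw h`** (proved for NO `h`): in such a support, an APEX letter of a THICK cell lies on the line of the cell's charged letters. -/
def ThickApexLaw (h : ℤ) : Prop :=
  ∀ C : MConfig, C.InDiamond h → C.G1Closed → C.StaticH1 → ∀ Z, (Z ∈ C.lower ∨ Z ∈ C.upper) → ¬ ThinCell Z →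
    ∀ f g, ¬ Charged (Z f) → Charged (Z g) → lineOf (Z f) = lineOf (Z g)

/-- a thick cell has two distinct charged factors. -/
theorem two_charged_of_not_thin {Z : MCell} (hZ : ¬ ThinCell Z) : ∃ g₁ g₂ : Fin 4, g₁ ≠ g₂ ∧ Charged (Z g₁) ∧ Charged (Z g₂) := by
  simp only [ThinCell, chargedCount, not_le] at hZ
  obtain ⟨g₁, hg₁, g₂, hg₂, hne⟩ := Finset.one_lt_card.mp hZ
  simp only [Finset.mem_filter, Finset.mem_univ, true_and] at hg₁ hg₂
  exact ⟨g₁, g₂, hne, hg₁, hg₂⟩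

/-- two distinct charged factors make a cell thick. -/
theorem not_thin_of_two_charged {Z : MCell} {g₁ g₂ : Fin 4} (hne : g₁ ≠ g₂) (h₁ : Charged (Z g₁)) (h₂ : Charged (Z g₂)) : ¬ ThinCell Z := by
  simp only [ThinCell, chargedCount, not_le]
  exact Finset.one_lt_card.mpr ⟨g₁, by simpa using h₁, g₂, by simpa using h₂, hne⟩

/-- **`LineConfinement h ↔ ChargedPairLaw h ∧ ThickApexLaw h`.** -/
theorem lineConfinement_iff_pair_apex (h : ℤ) : LineConfinement h ↔ ChargedPairLaw h ∧ ThickApexLaw h := by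
  constructor
  · intro H
    have single : ∀ C : MConfig, C.InDiamond h → C.G1Closed → C.StaticH1 → ∀ Z, (Z ∈ C.lower ∨ Z ∈ C.upper) → ¬ ThinCell Z →
        SingleLine Z := fun C hD hG hS Z hZ hth => by
      rcases hZ with hZ | hZ
      · exact (H C hD hG hS).1 Z hZ hth
      · exact (H C hD hG hS).2 Z hZ hth
    refine ⟨fun C hD hG hS Z hZ f g hf hg => ?_, fun C hD hG hS Z hZ hth f g _ _ => ?_⟩
    · by_cases hfg : f = g
      · rw [hfg]
      · have hs := single C hD hG hS Z hZ (not_thin_of_two_charged hfg hf hg)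
        show (Z f).1 + absCharge (Z f) = (Z g).1 + absCharge (Z g)
        rw [hs f, hs g]
    · have hs := single C hD hG hS Z hZ hth
      show (Z f).1 + absCharge (Z f) = (Z g).1 + absCharge (Z g)
      rw [hs f, hs g]
  · rintro ⟨HP, HA⟩ C hD hG hS
    have key : ∀ Z, (Z ∈ C.lower ∨ Z ∈ C.upper) → ¬ ThinCell Z → SingleLine Z := by
      intro Z hZ hth
      obtain ⟨g₁, g₂, hne, h₁, h₂⟩ := two_charged_of_not_thin hth
      have hall : ∀ f, lineOf (Z f) = lineOf (Z g₁) := fun f => by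
        by_cases hf : Charged (Z f)
        · exact HP C hD hG hS Z hZ f g₁ hf h₁
        · exact HA C hD hG hS Z hZ hth f g₁ hf h₁
      intro f
      show lineOf (Z f) = lineOf (Z 0)
      rw [hall f, hall 0]
    exact ⟨fun Z hZ hth => key Z (Or.inl hZ) hth, fun P hP hth => key P (Or.inr hP) hth⟩

/-! ## §7 KERNEL: `LineConfinement 2` — the bottom rung of the antitone ladder `LC 8 → LC 6 → LC 4 → LC 2` (§2), PROVED

◇₂ has the letters `O`, `2I` and the four floor∕ceiling units `ℓ_u = fu u` (lines 0, 2, 2). A multi-line thick cell of ◇₂ carries `O` and two units. The proof is the advertised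
shape — «X⁺∕A2I⁻ instability of any multi-line thick cell given RULE-D service» — and it CLOSES at `h = 2` because below a unit there is only `O` and above it (inside ◇₂) only
`2I`: (i) an `N`-cell with `O` and `ℓ_u` is also a `P`-cell ((R-N0) forces the cancellation, the tree's `a2i_swap_kill` + `S₄` transfer it); (ii) a `P`-cell with `O`, `ℓ_u`, `ℓ_v` lifts
`ℓ_v ↦ 2I` ((R-P_h)), which by (i) is again a `P`-cell; (iii) a `P`-cell `[O | ℓ_u | 2I | x]` is contradictory: (R-P_h) lifts `ℓ_u ↦ 2I` at level `N` and raises `O` in two directions at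
level `N`, (R-N0) at the raised cell cancels `ℓ_u`, `S₄` turns that into the sibling `[O | ℓ_r | 2I | x] ∈ P`, `r ≠ u`, and the tree's `X⁺` ceiling kill fires. Deletion-minimal machine core
of the same statement: 40 clauses (`work/py/core.py 2 full multi --mus`); at ◇₄ the analogous cores are ≈ 400–600 (§4 of READ-F2) — the argument does not close one rung up. -/

section HeightTwo

variable {C : MConfig}

/-- the letters of ◇₂: `O`, the top node `2I`, the units `ℓ_u`. -/
theorem letters_h2 {x : BPoint} (hx : InDiamond 2 x) : x = (0, 0, 0) ∨ x = (2, 0, 0) ∨ ∃ u : Fin 4, x = fu u := by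
  obtain ⟨t, c, κ, ht, hc, hpar, hh, -, rfl⟩ := shape_of_inDiamond hx
  rcases (show (t = 0 ∧ c = 0) ∨ (t = 2 ∧ c = 0) ∨ (t = 0 ∧ c = 1) by omega) with ⟨rfl, rfl⟩ | ⟨rfl, rfl⟩ | ⟨rfl, rfl⟩
  · left; fin_cases κ <;> simp [ray]
  · right; left; fin_cases κ <;> simp [ray]
  · right; right; exact ⟨κ, rfl⟩

/-- a unit is neither `O` nor `2I`, lies on the floor, on the ceiling of ◇₂, and on line 2; `O` is on the floor, `2I` on the ceiling. [`decide` per phase] -/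
theorem fu_facts (u : Fin 4) : fu u ≠ (0, 0, 0) ∧ fu u ≠ (2, 0, 0) ∧ OnFloor (fu u) ∧ OnCeiling 2 (fu u) ∧ lineOf (fu u) = 2 ∧ (fu u).1 = 1 ∧
    Charged (fu u) ∧ cuH 2 u = fu u := by
  fin_cases u <;> decide

/-- a charged ◇₂ letter is a unit. -/
theorem charged_h2 {x : BPoint} (hx : InDiamond 2 x) (hc : Charged x) : ∃ u : Fin 4, x = fu u := by
  rcases letters_h2 hx with rfl | rfl | h
  · exact absurd rfl hc
  · exact absurd rfl hc
  · exact h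

/-- a ◇₂ letter other than `O` lies on line 2. -/
theorem lineOf_h2 {x : BPoint} (hx : InDiamond 2 x) (hO : x ≠ (0, 0, 0)) : lineOf x = 2 := by
  rcases letters_h2 hx with rfl | rfl | ⟨u, rfl⟩
  · exact absurd rfl hO
  · decide
  · exact (fu_facts u).2.2.2.2.1

/-- agreement off one factor pins a cell down to a `Function.update` (both readings of `MAgree P N g`: «`P` agrees with `N` off `g`»). -/
theorem eq_update_of_magree {P N : MCell} {g : Fin 4} (h : MAgree P N g) : N = Function.update P g (N g) := by
  funext f
  by_cases hf : f = g
  · subst hf; simp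
  · rw [Function.update_of_ne hf]; exact (h f hf).symm

/-- … and the other cell. -/
theorem eq_update_of_magree' {P N : MCell} {g : Fin 4} (h : MAgree P N g) : P = Function.update N g (P g) := by
  funext f
  by_cases hf : f = g
  · subst hf; simp
  · rw [Function.update_of_ne hf]; exact h f hf

/-- in ◇₂, a partner strictly BELOW a unit sits at `O`. -/
theorem below_fu_h2 {Z P : MCell} {σ u k : Fin 4} (hP : InDiamond 2 (P σ)) (hZσ : Z σ = fu u) (h : UPartner Z P σ k) :
    P = Function.update Z σ (0, 0, 0) := by
  obtain ⟨hag, hlt, -⟩ := h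
  have h1 : (P σ).1 = 0 := by
    have := inDiamond_nonneg hP; rw [hZσ, (fu_facts u).2.2.2.2.2.1] at hlt; omega
  rw [eq_update_of_magree' hag, eq_O_of_inDiamond hP h1]

/-- in ◇₂, a server strictly ABOVE a unit sits at the top node `2I`. -/
theorem above_fu_h2 {N P : MCell} {g v k : Fin 4} (hN : InDiamond 2 (N g)) (hPg : P g = fu v) (h : UPartner N P g k) :
    N = Function.update P g (2, 0, 0) := by
  obtain ⟨hag, hlt, -⟩ := h
  have h1 : (N g).1 = 2 := by
    have := inDiamond_le_top hN; rw [hPg, (fu_facts v).2.2.2.2.2.1] at hlt; omega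
  rw [eq_update_of_magree hag, eq_top_of_inDiamond hN h1]

/-- in ◇₂, a server strictly ABOVE the apex `O` in direction `r` is the unit `ℓ_r`. -/
theorem above_O_h2 {N P : MCell} {g r : Fin 4} (hN : InDiamond 2 (N g)) (hPg : P g = (0, 0, 0)) (h : UPartner N P g r) :
    N = Function.update P g (fu r) := by
  obtain ⟨hag, hlt, hray⟩ := h
  rw [hPg] at hlt hray
  simp only [sub_zero] at hray
  have hA := hN.2.2.2
  rw [hray] at hA
  obtain ⟨hcabs, -⟩ := coords_of_shape 0 (le_of_lt hlt) r
  rw [hcabs] at hA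
  have he : (N g).1 = 1 := by
    have : (ray ((0 : ℤ), (0 : ℤ), (0 : ℤ)) r (N g).1).1 = (N g).1 := by fin_cases r <;> simp
    rw [this] at hA; simp only at hlt; omega
  rw [eq_update_of_magree hag, hray, he]

/-- the swap of two factors of a `Function.update`d cell, as needed twice below: if `X i = a`, then `(X(σ ↦ b)) ∘ (i σ) = X(i ↦ b)(σ ↦ a)`… stated
concretely: for `X` with `X i = a`, the cell `fun f => (Function.update X σ b) (Equiv.swap i σ f)` equals `Function.update (Function.update X σ a) i b`. -/
theorem perm_swap_update {X : MCell} {i σ : Fin 4} (hiσ : i ≠ σ) {a b : BPoint} (hXi : X i = a) :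
    MCell.perm (Equiv.swap i σ) (Function.update X σ b) = Function.update (Function.update X σ a) i b := by
  funext f
  simp only [MCell.perm]
  by_cases hfi : f = i
  · subst hfi; simp
  · by_cases hfσ : f = σ
    · subst hfσ
      rw [Equiv.swap_apply_right, Function.update_of_ne hiσ, Function.update_of_ne hfi, Function.update_self]
      exact hXi
    · rw [Equiv.swap_apply_of_ne_of_ne hfi hfσ, Function.update_of_ne hfσ, Function.update_of_ne hfi, Function.update_of_ne hfσ]

/-- **(i) TRANSFER `N → P`**: in an `H₁`-static `G₁`-closed ◇₂ support, an `N`-cell with `O` on `i` and a unit on `σ` is also a `P`-cell.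
[(R-N0) `floor_forces_own_leg` gives the cancellation `Z(σ ↦ O) ∈ P`; `S₄` gives the swapped cell at level `N`; the tree's `a2i_swap_kill` puts it at level `P`;
`S₄` again.] -/
theorem upper_of_lower_O_fu (hU : C.InDiamond 2) (hG : C.G1Closed) (hS : C.StaticH1) {Z : MCell} (hZ : Z ∈ C.lower)
    {i σ : Fin 4} (hiσ : i ≠ σ) (hZi : Z i = (0, 0, 0)) {u : Fin 4} (hZσ : Z σ = fu u) : Z ∈ C.upper := by
  obtain ⟨P, hP, hPZ⟩ := floor_forces_own_leg hU hZ (hS.1.1 Z hZ) (Ne.symm hiσ) (by rw [hZi]; decide) (t := 0) (le_refl _)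
    (le_refl _) (κ := u) (by rw [hZσ])
  have hq : Function.update Z σ (0, 0, 0) ∈ C.upper := by rw [← below_fu_h2 (hU.2 P hP σ) hZσ hPZ]; exact hP
  have hsw : Function.update (Function.update Z σ (0, 0, 0)) i (fu u) ∈ C.lower := by
    rw [← perm_swap_update hiσ hZi (b := fu u)]
    have : Function.update Z σ (fu u) = Z := by rw [← hZσ]; exact Function.update_eq_self σ Z
    rw [this]; exact hG.1 _ Z hZ
  have hsw' := a2i_swap_kill hU hS.2.2 hZ hiσ hZσ hZi hq hsw
  have e : MCell.perm (Equiv.swap i σ) (Function.update (Function.update Z σ (0, 0, 0)) i (fu u)) = Z := by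
    funext f
    simp only [MCell.perm]
    by_cases hfi : f = i
    · subst hfi
      rw [Equiv.swap_apply_left, Function.update_of_ne (Ne.symm hiσ), Function.update_self, hZi]
    · by_cases hfσ : f = σ
      · subst hfσ; rw [Equiv.swap_apply_right, Function.update_self, hZσ]
      · rw [Equiv.swap_apply_of_ne_of_ne hfi hfσ, Function.update_of_ne hfi, Function.update_of_ne hfσ]
  rw [← e]; exact hG.2.1 _ _ hsw'

/-- **(iii) THE KILL**: no `P`-cell of an `H₁`-static `G₁`-closed ◇₂ support carries `O`, a unit `ℓ_u` and the top node `2I` on three distinct factors.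
[(R-P_h): the lift `P(σ ↦ 2I) ∈ N` (`lift_of_ceiling_unit_h`) and two raises `P(i ↦ ℓ_{r}) ∈ N`; (R-N0) at a raise with `r ≠ u` cancels `ℓ_u`; `S₄` makes it the sibling
`P(σ ↦ ℓ_r) ∈ P`; `xplus_ceiling_kill_h`.] -/
theorem no_upper_O_fu_top (hU : C.InDiamond 2) (hG : C.G1Closed) (hS : C.StaticH1) {P : MCell} (hP : P ∈ C.upper)
    {i σ g : Fin 4} (hiσ : i ≠ σ) (hig : i ≠ g) (hσg : σ ≠ g) (hPi : P i = (0, 0, 0)) {u : Fin 4} (hPσ : P σ = fu u)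
    (hPg : P g = (2, 0, 0)) : False := by
  have hcu : P σ = cuH 2 u := by rw [hPσ, (fu_facts u).2.2.2.2.2.2.2]
  -- the lift
  have hlift : Function.update P σ (topH 2) ∈ C.lower := lift_of_ceiling_unit_h hU (hS.1.2 P hP) (Ne.symm hσg) hcu hPg
  -- two raises of the apex `O` on `i`
  obtain ⟨r₁, r₂, hr, ⟨N₁, hN₁, hN₁P⟩, ⟨N₂, hN₂, hN₂P⟩⟩ :=
    ceiling_forces_two_dirs hU hP (hS.1.2 P hP) hig (by rw [hPg]; decide) (t := 0) (by decide) hPi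
  -- one of them is not the own direction `u`
  obtain ⟨r, hru, N, hN, hNP⟩ : ∃ r, r ≠ u ∧ ∃ N ∈ C.lower, UPartner N P i r := by
    by_cases h1 : r₁ = u
    · exact ⟨r₂, fun h2 => hr (h1.trans h2.symm), N₂, hN₂, hN₂P⟩
    · exact ⟨r₁, h1, N₁, hN₁, hN₁P⟩
  have hNeq : N = Function.update P i (fu r) := above_O_h2 (hU.1 N hN i) hPi hNP
  -- (R-N0) at the raised cell: cancel the unit on σ
  have hNi : N i = fu r := by rw [hNeq]; simp
  have hNσ : N σ = fu u := by rw [hNeq, Function.update_of_ne (Ne.symm hiσ), hPσ]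
  obtain ⟨Q, hQ, hQN⟩ := floor_forces_own_leg hU hN (hS.1.1 N hN) (Ne.symm hiσ) (by rw [hNi]; exact (fu_facts r).2.2.1) (t := 0)
    (le_refl _) (le_refl _) (κ := u) (by rw [hNσ])
  have hQeq : Q = Function.update N σ (0, 0, 0) := below_fu_h2 (hU.2 Q hQ σ) hNσ hQN
  -- S₄: the sibling `P(σ ↦ ℓ_r)` is a P-cell
  have hsib : Function.update P σ (cuH 2 r) ∈ C.upper := by
    rw [(fu_facts r).2.2.2.2.2.2.2]
    have e : MCell.perm (Equiv.swap i σ) Q = Function.update P σ (fu r) := by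
      rw [hQeq, hNeq]
      funext f
      simp only [MCell.perm]
      by_cases hfi : f = i
      · subst hfi
        rw [Equiv.swap_apply_left, Function.update_self, Function.update_of_ne hiσ, hPi]
      · by_cases hfσ : f = σ
        · subst hfσ
          rw [Equiv.swap_apply_right, Function.update_of_ne hiσ, Function.update_self, Function.update_self]
        · rw [Equiv.swap_apply_of_ne_of_ne hfi hfσ, Function.update_of_ne hfσ, Function.update_of_ne hfi, Function.update_of_ne hfσ]
    rw [← e]; exact hG.2.1 _ Q hQ
  exact xplus_ceiling_kill_h hU hS.2.1 hP (Ne.symm hσg) hru hcu hPg hlift hsib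

/-- **(ii) no `P`-cell with `O` and two units.** [(R-P_h) `ceiling_forces_antip_server` lifts the second unit to `2I` at level `N`; (i) transfers; (iii) kills.] -/
theorem no_upper_O_fu_fu (hU : C.InDiamond 2) (hG : C.G1Closed) (hS : C.StaticH1) {P : MCell} (hP : P ∈ C.upper)
    {i σ g : Fin 4} (hiσ : i ≠ σ) (hig : i ≠ g) (hσg : σ ≠ g) (hPi : P i = (0, 0, 0)) {u v : Fin 4} (hPσ : P σ = fu u)
    (hPg : P g = fu v) : False := by
  obtain ⟨N, hN, hNP⟩ := ceiling_forces_antip_server hU hP (hS.1.2 P hP) (Ne.symm hσg) (by rw [hPσ]; exact (fu_facts u).2.2.2.1)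
    (t := 0) (le_refl _) (κ := v) (by rw [hPg])
  have hNeq : N = Function.update P g (2, 0, 0) := above_fu_h2 (hU.1 N hN g) hPg hNP
  have hNi : N i = (0, 0, 0) := by rw [hNeq, Function.update_of_ne hig, hPi]
  have hNσ : N σ = fu u := by rw [hNeq, Function.update_of_ne hσg, hPσ]
  have hNg : N g = (2, 0, 0) := by rw [hNeq]; simp
  exact no_upper_O_fu_top hU hG hS (upper_of_lower_O_fu hU hG hS hN hiσ hNi hNσ) hiσ hig hσg hNi hNσ hNg

/-- the same at level `N`, by (i). -/
theorem no_lower_O_fu_fu (hU : C.InDiamond 2) (hG : C.G1Closed) (hS : C.StaticH1) {Z : MCell} (hZ : Z ∈ C.lower)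
    {i σ g : Fin 4} (hiσ : i ≠ σ) (hig : i ≠ g) (hσg : σ ≠ g) (hZi : Z i = (0, 0, 0)) {u v : Fin 4} (hZσ : Z σ = fu u)
    (hZg : Z g = fu v) : False :=
  no_upper_O_fu_fu hU hG hS (upper_of_lower_O_fu hU hG hS hZ hiσ hZi hZσ) hiσ hig hσg hZi hZσ hZg

/-- **`LineConfinement 2` (KERNEL).** In a `◇₂`-supported, `G₁`-closed, `H₁`-static support every thick cell is single-line (indeed it avoids `O`, so all its
letters lie on line 2). -/
theorem lineConfinement_two : LineConfinement 2 := by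
  intro C hU hG hS
  have key : ∀ Z, (Z ∈ C.lower ∨ Z ∈ C.upper) → ¬ ThinCell Z → SingleLine Z := by
    intro Z hZ hth
    have hZD : ∀ f, InDiamond 2 (Z f) := fun f => hZ.elim (fun h => hU.1 Z h f) (fun h => hU.2 Z h f)
    obtain ⟨g₁, g₂, hne, h₁, h₂⟩ := two_charged_of_not_thin hth
    obtain ⟨u, hu⟩ := charged_h2 (hZD g₁) h₁
    obtain ⟨v, hv⟩ := charged_h2 (hZD g₂) h₂
    have noO : ∀ f, Z f ≠ (0, 0, 0) := by
      intro f hf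
      have hf1 : f ≠ g₁ := by rintro rfl; rw [hu] at hf; exact (fu_facts u).1 hf
      have hf2 : f ≠ g₂ := by rintro rfl; rw [hv] at hf; exact (fu_facts v).1 hf
      rcases hZ with hZ | hZ
      · exact no_lower_O_fu_fu hU hG hS hZ hf1 hf2 hne hf hu hv
      · exact no_upper_O_fu_fu hU hG hS hZ hf1 hf2 hne hf hu hv
    intro f
    show lineOf (Z f) = lineOf (Z 0)
    rw [lineOf_h2 (hZD f) (noO f), lineOf_h2 (hZD 0) (noO 0)]
  exact ⟨fun Z hZ hth => key Z (Or.inl hZ) hth, fun P hP hth => key P (Or.inr hP) hth⟩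

end HeightTwo

/-! ## §8 Two h-UNIFORM edges of the death DAG: the «easy» multi-line thick deaths next to the ceiling kill

The machine cores at FULL ◇₄ are strongly skewed (sample of 150 multi-line thick dead orbit-literals, `coresample.py`): LRAT-cone sizes min 4, median 32, p90 196,
max 398. The 4–6-clause deaths are chains «(R-P_h) lift → (R-N0) cancellation → the tree's apex–apex–ceiling-unit–top `X⁺` kill», and those chains are UNIFORM IN `h`.
Two of them, typed for every `h` (positions fixed; other positions by `S₄`): no `N`-cell `[O | ℓ_v | (h−2)I+ℓ_u | hI]` and no `P`-cell `[O | ℓ_v | (h−2)I+ℓ_u | (h−2)I+ℓ_{u'}]`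
(lines `0, 2, h, h`: thick and multi-line for `h ≥ 4`). The hard deaths (near-alive cells such as `N[O|O|ℓ|ℓ]`, core 390 at ◇₄) are NOT of this kind. -/

section EasyDeaths

variable {C : MConfig} {h : ℤ}

/-- updating the second letter of an explicit cell. -/
theorem update_mcellOf_one (a b c d x : BPoint) : Function.update (mcellOf a b c d) 1 x = mcellOf a x c d := by
  funext f; fin_cases f <;> rfl

/-- updating the third letter of an explicit cell. -/
theorem update_mcellOf_two (a b c d x : BPoint) : Function.update (mcellOf a b c d) 2 x = mcellOf a b x d := by
  funext f; fin_cases f <;> rfl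

/-- swapping the last two factors of an explicit cell. -/
theorem perm_swap23_mcellOf (a b c d : BPoint) : MCell.perm (Equiv.swap 2 3) (mcellOf a b c d) = mcellOf a b d c := by
  funext f; fin_cases f <;> rfl

/-- inside ◇_h, strictly below a floor unit `ℓ_v` there is only `O`. -/
theorem eq_O_of_below_fu {y : BPoint} (hy : InDiamond h y) {v : Fin 4} (hlt : y.1 < (fu v).1) : y = (0, 0, 0) := by
  have h0 := inDiamond_nonneg hy
  have h1 : (fu v).1 = 1 := by fin_cases v <;> rfl
  exact eq_O_of_inDiamond hy (by omega)

/-- inside ◇_h, strictly above the ceiling unit `(h−2)I+ℓ_u` there is only the top node `hI`. -/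
theorem eq_top_of_above_cu {y : BPoint} (hy : InDiamond h y) {u : Fin 4} (hlt : (cuH h u).1 < y.1) : y = topH h := by
  have hle := inDiamond_le_top hy
  have h1 : (cuH h u).1 = h - 1 := by fin_cases u <;> simp <;> ring
  exact eq_top_of_inDiamond hy (by omega)

/-- **no `N`-cell `[O | ℓ_v | (h−2)I+ℓ_u | hI]`** on an `H₁`-static `G₁`-closed ◇_h support: (R-N0) cancels the unit (`floor_forces_own_leg`; below `ℓ_v` only `O`),
and the cancellation `[O | O | (h−2)I+ℓ_u | hI] ∈ P` is the tree's forbidden cell `not_mem_apex_apex_cu_top_h`. -/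
theorem not_lower_O_fu_cu_top (hU : C.InDiamond h) (hG : C.G1Closed) (hS : C.StaticH1) (v u : Fin 4) :
    mcellOf (0, 0, 0) (fu v) (cuH h u) (topH h) ∉ C.lower := by
  intro hZ
  obtain ⟨P, hP, hPZ⟩ := floor_forces_own_leg hU hZ (hS.1.1 _ hZ) (i := 0) (g := 1) (by decide)
    (by change OnFloor ((0 : ℤ), (0 : ℤ), (0 : ℤ)); decide) (t := 0) (le_refl _) (le_refl _) (κ := v) rfl
  obtain ⟨hag, hlt, -⟩ := hPZ
  have hP1 : P 1 = (0, 0, 0) := eq_O_of_below_fu (hU.2 P hP 1) hlt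
  have hPeq : P = mcellOf (0, 0, 0) (0, 0, 0) (cuH h u) (topH h) := by
    rw [eq_update_of_magree' hag, hP1]; exact update_mcellOf_one _ _ _ _ _
  exact not_mem_apex_apex_cu_top_h hU hG hS (x := (0, 0, 0)) (y := (0, 0, 0)) (by decide) (by decide) u (hPeq ▸ hP)

/-- **no `P`-cell `[O | ℓ_v | (h−2)I+ℓ_u | (h−2)I+ℓ_{u'}]`**: (R-P_h) at the ceiling letter on factor 3 forces the antipodal-up server of the ceiling unit on
factor 2 (`ceiling_forces_antip_server`; above it only `hI`), i.e. `[O | ℓ_v | hI | (h−2)I+ℓ_{u'}] ∈ N`; `S₄` swaps the last two factors; `not_lower_O_fu_cu_top`. -/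
theorem not_upper_O_fu_cu_cu (hU : C.InDiamond h) (hG : C.G1Closed) (hS : C.StaticH1) (v u u' : Fin 4) :
    mcellOf (0, 0, 0) (fu v) (cuH h u) (cuH h u') ∉ C.upper := by
  intro hP
  have hc2 := (hU.2 _ hP 3)
  have hcl : OnCeiling h (cuH h u') := by
    obtain ⟨hcabs, -⟩ := coords_of_shape (h - 2) (show (0 : ℤ) ≤ 1 by decide) u'
    show (cuH h u').1 + absCharge (cuH h u') = h
    rw [hcabs]; fin_cases u' <;> simp <;> ring
  obtain ⟨N, hN, hNP⟩ := ceiling_forces_antip_server hU hP (hS.1.2 _ hP) (i := 3) (g := 2) (by decide) hcl (t := h - 2)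
    (show (1 : ℤ) ≤ 1 from le_refl _) (κ := u) rfl
  obtain ⟨hag, hlt, -⟩ := hNP
  have hN2 : N 2 = topH h := eq_top_of_above_cu (hU.1 N hN 2) hlt
  have hNeq : N = mcellOf (0, 0, 0) (fu v) (topH h) (cuH h u') := by
    rw [eq_update_of_magree hag, hN2]; exact update_mcellOf_two _ _ _ _ _
  have hsw := hG.1 (Equiv.swap 2 3) N hN
  rw [hNeq, perm_swap23_mcellOf] at hsw
  exact not_lower_O_fu_cu_top hU hG hS v u' hsw

end EasyDeaths

/-! ## §9 Probes (`decide`): the restated predicates compute as in ThinnessTarget §4, and the multi-line thick cells of the A19 anatomy -/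

/-- `N[4I|4I|4I+2ℓ₋₁|4I+2ℓᵢ]` (the RULE-D + `X⁺` survivor of READ-A19, killed by `A2I⁻`) is thick and NOT single-line (lines 4,4,8,8). -/
example : ¬ ThinCell (mcellOf (4, 0, 0) (4, 0, 0) (6, -2, 0) (6, 0, -2)) ∧ ¬ SingleLine (mcellOf (4, 0, 0) (4, 0, 0) (6, -2, 0) (6, 0, -2)) := by
  constructor <;> decide

/-- `P[6I|6I+ℓ₋₁|6I+ℓ₁|8I]` (the `X⁺ + A2I⁻`-without-RULE-D survivor) is thick and not single-line. -/
example : ¬ ThinCell (mcellOf (6, 0, 0) (7, -1, 0) (7, 1, 0) (8, 0, 0)) ∧ ¬ SingleLine (mcellOf (6, 0, 0) (7, -1, 0) (7, 1, 0) (8, 0, 0)) := by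
  constructor <;> decide

/-- `P[4I+ℓ₋₁|4I+ℓ₁|6I|6I]` (a single-line thick survivor on line 6 under `H₁`) is thick AND single-line. -/
example : ¬ ThinCell (mcellOf (5, -1, 0) (5, 1, 0) (6, 0, 0) (6, 0, 0)) ∧ SingleLine (mcellOf (5, -1, 0) (5, 1, 0) (6, 0, 0) (6, 0, 0)) := by
  constructor <;> decide

end ConfinementKernel

end AnomalyLens

end Summit.Ventures.HSemireg.Pad4Tower
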